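import Summits.QuantumFields.YangMills.Theorems.BalabanUVNodesC44IterMhConePr
import Summits.QuantumFields.YangMills.Theorems.BalabanUVNodesC44IterMhProp4Node00PrParam
import HarnessLib

/-!
# THE (ℓd) AND CONE DOORS OF THE FRAMED PROP. 4, PARAMETRIC IN THE FRAME CONSTANT — G-door 2 ✓`…Prop4ColumnsAtRecordPr` and the cone door ✓`…C44IterMhConePr`
# RE-PRESSED (`…_param`): `c𝔥 ∈ [0, 10¹⁰]` A BINDER, `C₂(c𝔥) = (6.4·10¹²·c𝔥 + 2.56·10¹⁶)·L·N` (file 1 of 2 of the downstream doors)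

Cell `pub-ymgap` ∕ `ym-nodeO-ideate`, porter lineage `ymgap-nodeO-port-PTB-1` (gen 10); director-ym g24 №630 (2)(iii) (parametric re-press, commissioned; deprecate-and-add, new decl
names; the `≤ 1000` editions stay as the special case they are).  `--kind proof --supports stmt-QuantumFields-27238 --as helper`; count-neutral; NEW basename; nothing appended,
nothing re-declared; ONE topic (two of the four downstream doors of the Pr chain; the other two in ✓`…Prop4ConeDoorsPrParam`), each in its source file's namespace and `open` context.
[B11] = [Balaban1985Variational]; [B9] = [Balaban1985BackgroundPropagators]; [B7] = [Balaban1985Averaging].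

WHAT IS PROVED (0 def, 0 sorry, axioms standard):
* `Prop4UniformAtRecord.prop4UniformPrAtRecord_node00_of_kernelLetters_param` (G-door 2: (ℓd)ᵖʳ from the kernel letters (KL-H)∕(KL-C)∕(KL-N));
* `C44IterMh.prop4UniformPrAtRecord_node00_of_coneLetterPr_param` (the cone door: (KL-C) from the on-cone entry letter `g₀` + (hmap)∕(hderiv)).
Statements VERBATIM from the sources but for `{c𝔥 : ℝ} (hc0 : 0 ≤ c𝔥) (hc : c𝔥 ≤ 10¹⁰)` in place of `(hc : c𝔥 ≤ 1000)` and `C₂ := (6.4·10¹²·c𝔥 + 2.56·10¹⁶)·L·N` in every `letI`;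
proofs = the same glue with the `_param` suppliers (✓`prop4LetterCPrAtRecord_of_regular_param`, ✓`prop4UniformPrAtRecord_node00_of_HCol_pos_param`).

HONEST FRAMING.  Glue; (ℓa-H)ᵖʳ, (KL-H), (KL-C)∕`g₀`, (KL-N), (hdom)∕(hnear)∕(hmap)∕(hderiv) DISPLAYED (the frame debts are THEOREMS at the record's own datum, instantiated in the sequel);
constants crude; (R1)∕(R2) and [B7] Prop. 5 OPEN; K0ᴬ ⟨stmt-QuantumFields-27238⟩ NOT closed; NODE O 0∕1; COUNT 8∕28 · K 1∕4 UNMOVED; finite `𝕋⁴_{L^K}` at fixed ε — NOT continuum ∕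
ℝ⁴ ∕ OS ∕ Clay; **the Yang–Mills mass gap (Clay) is NOT proved by any of this.**  No `sorry`, `instance`, `notation`, `set_option`; standard axioms.
-/

noncomputable section

open scoped Matrix Matrix.Norms.L2Operator InnerProductSpace ComplexConjugate Topology BigOperators

namespace Summit.QuantumFields.YangMills.Theorems.Prop4UniformAtRecord

section ColumnsDoor

open Literature.MathematicalPhysics.QuantumFieldTheory.Balaban1983to89
open T4Continuum BlockAveraging
open B9SectCLatticeCarrier (Bond)
open B11Eq103H1Complex (SiteL2K)
open B11Eq111FrakG (nabla115)
open B11Eq115Space (NegSup NegSize Space115 levWeight levWeight_pos)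
open B11Eq90Transpose (kernel single115)
open B11Eq90V0primeCurrent (flat115)
open B11Prop6Scheme (Prop4Hyp)
open B11Eq118RegimeRadiiUniform (radius_pos)
open Node00
open Summit.QuantumFields.YangMills.Theorems.C44IterMh (prop4LetterCPrAtRecord_of_regular_param prop4UniformPrAtRecord_node00_of_HCol_pos_param)

variable (F : T4Family) (N : ℕ) [NeZero N] (K k : ℕ) (Ω : ℕ → Set (Site (F.P K) 0)) (U₀ : GaugeField (F.P K) 0 (SU N))
variable [Fact (0 < (F.L : ℝ))] [Fact (0 < (F.P K).eta k)] [Fact (0 < c0Rec F K k)] [Fact (∀ c, 0 < wBRec F K k c)]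

/-- ★★ **G-DOOR 2 ((ℓd)ᵖʳ FROM THE KERNEL LETTERS), PARAMETRIC IN `c𝔥`** — ✓`prop4UniformPrAtRecord_node00_of_kernelLetters` with `{c𝔥} (hc0 : 0 ≤ c𝔥) (hc : c𝔥 ≤ 10¹⁰)` and `C₂ := (6.4·10¹²·c𝔥 + 2.56·10¹⁶)·L·N`; glue over ✓`prop4UniformPrAtRecord_node00_of_HCol_pos_param` ∘ ✓`prop4LetterColumnsPrAtRecord_of_kernelLetters`.
[cite: Balaban1985Variational, Prop. 4 (97)–(98) pp.292–293, (14) p.280, (44)–(46) p.285, (73) p.289, (86)–(89) p.291; Balaban1985BackgroundPropagators, (3.132) p.422; Balaban1985Averaging, Proposition 5 (157) p.42] -/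
theorem prop4UniformPrAtRecord_node00_of_kernelLetters_param [DecidableEq (PBond (F.P K) k)] (𝔥 : FrameDatum (F.P K) N k U₀) (levB : PBond (F.P K) k → ℕ) (a : ℝ)
    (hpos : ∀ x, x ≠ 0 → 0 < RCLike.re ⟪x, laplaceAOfRecord F N k U₀ (QprOfRecord F N k U₀ 𝔥) (QprimeOfRecord F N k U₀) a x⟫_ℂ)
    (hQ : Function.Surjective (QprOfRecord F N k U₀ 𝔥))
    (Gp : SiteL2K ℂ (F.P K).d (fun _ => (F.P K).sitesPerDir 0) (c0Rec F K k) (WRec N) →ₗ[ℂ]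
      SiteL2K ℂ (F.P K).d (fun _ => (F.P K).sitesPerDir 0) (c0Rec F K k) (WRec N))
    {b α nJ : ℝ} (hkpos : 0 < k) (hb : 0 ≤ b) (hΩ : ∀ x, x ∈ Ω k) (hα0 : 0 ≤ α) (hα : α * (11000000 * N) ≤ 1)
    (hreg : ∀ j, j < k → PlaqSmall (α * ((F.L : ℝ) ^ j * (F.P K).eta k) ^ 2) (Averaging.iter (avOfRecord F N K) j U₀))
    {c𝔥 : ℝ} (hc0 : 0 ≤ c𝔥) (hc : c𝔥 ≤ 10000000000)
    (hdom : ∀ Y : PBond (F.P K) 0 → Matrix (Fin N) (Fin N) ℂ, (∀ b, (Y b).trace = 0) → (F.L : ℝ) ^ k * ‖Y‖ < 1 / (25000000000 * (F.L : ℝ) * N) →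
      expOver U₀ Y ∈ 𝔥.dom)
    (hnear : ∀ Y : PBond (F.P K) 0 → Matrix (Fin N) (Fin N) ℂ, (∀ b, (Y b).trace = 0) → (F.L : ℝ) ^ k * ‖Y‖ < 1 / (25000000000 * (F.L : ℝ) * N) →
      ∀ y : Site (F.P K) k, ‖𝔥.map (expOver U₀ Y) y - 1‖ ≤ c𝔥 * ((F.L : ℝ) ^ k * ‖Y‖) ∧ ‖𝔥.inv (expOver U₀ Y) y - 1‖ ≤ c𝔥 * ((F.L : ℝ) ^ k * ‖Y‖))
    (hH : Prop4LetterHPrAtRecord F N K k Ω U₀ 𝔥 levB a hpos hQ b)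
    -- (KL-H)
    {hk : Bond (F.P K).d (fun _ => (F.P K).sitesPerDir 0) → PBond (F.P K) k → ℝ} (hk0 : ∀ b' y, 0 ≤ hk b' y)
    (hHk : ∀ (y : PBond (F.P K) k) (Z : Matrix (Fin N) (Fin N) ℂ) (b' : Bond (F.P K).d (fun _ => (F.P K).sitesPerDir 0)),
      ‖flat115 (H1prOfRecordAtBg F N K k Ω U₀ 𝔥 levB a hpos hQ
          ((NegSup.equiv (levWeight (F.L : ℝ) ((F.P K).eta k) levB 0) (Matrix (Fin N) (Fin N) ℂ)).symm (Pi.single y Z))) b'‖ ≤ hk b' y * ‖Z‖)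
    {ΘH : ℝ} (hΘH : 0 ≤ ΘH) (hH1 : ∀ y, ∑ b', hk b' y ≤ ΘH) {ΘHw : ℝ} (hΘHw : 0 ≤ ΘHw)
    (hHw : ∀ (bb : Bond (F.P K).d (fun _ => (F.P K).sitesPerDir 0)) (y : PBond (F.P K) k),
      ∑ b', levWeight (F.L : ℝ) ((F.P K).eta k) (bondLevLit F Ω k) 3 bb / levWeight (F.L : ℝ) ((F.P K).eta k) (bondLevLit F Ω k) 3 b' * hk b' y ≤ ΘHw)
    -- (KL-C) on `‖A‖ < 2r` and the window `2r·Θ_H·G ≤ ½`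
    {gC : PBond (F.P K) k → Bond (F.P K).d (fun _ => (F.P K).sitesPerDir 0) → ℝ} (hgC0 : ∀ y bb, 0 ≤ gC y bb)
    (hCg : letI C₂ : ℝ := (6400000000000 * c𝔥 + 25600000000000000) * (F.L : ℝ) * N
      letI c₄ : ℝ := 1 / (200000000000 * (F.L : ℝ) * N)
      letI r : ℝ := min (c₄ / 4) (min (1 / 2) (1 / (16 * (b * C₂ + 1))))
      ∀ A : Space115Lit F N K k Ω U₀, ‖A‖ < r + r → ∀ (bb : Bond (F.P K).d (fun _ => (F.P K).sitesPerDir 0)) (X : Matrix (Fin N) (Fin N) ℂ)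
      (y : PBond (F.P K) k), ‖NegSup.equiv (levWeight (F.L : ℝ) ((F.P K).eta k) levB 0) (Matrix (Fin N) (Fin N) ℂ)
        (fderiv ℂ (CslprOfRecord F N K k Ω U₀ 𝔥 levB) A
          (single115 (lev₁ := pairLevLit F Ω k) (Dc := nabla115 ((F.P K).eta k) (unitsOfRecord F N U₀)) bb X)) y‖ ≤ gC y bb * ‖A‖ * ‖X‖)
    {G : ℝ} (hG0 : 0 ≤ G) (hG : ∀ bb, ∑ y, gC y bb ≤ G)
    (hq : letI C₂ : ℝ := (6400000000000 * c𝔥 + 25600000000000000) * (F.L : ℝ) * N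
      letI c₄ : ℝ := 1 / (200000000000 * (F.L : ℝ) * N)
      letI r : ℝ := min (c₄ / 4) (min (1 / 2) (1 / (16 * (b * C₂ + 1))))
      (r + r) * ΘH * G ≤ 1 / 2)
    -- (KL-N)
    {hk' : Bond (F.P K).d (fun _ => (F.P K).sitesPerDir 0) → PBond (F.P K) k → ℝ} (hk'0 : ∀ b' y, 0 ≤ hk' b' y)
    (hNk : ∀ (y : PBond (F.P K) k) (Z : Matrix (Fin N) (Fin N) ℂ) (b' : Bond (F.P K).d (fun _ => (F.P K).sitesPerDir 0)),
      ‖NegSup.equiv (levWeight (F.L : ℝ) ((F.P K).eta k) (bondLevLit F Ω k) 3) (Matrix (Fin N) (Fin N) ℂ)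
        (DeltaPiCurOfRecord F N K k Ω U₀ Gp (QprimeOfRecord F N k U₀) (H1prOfRecordAtBg F N K k Ω U₀ 𝔥 levB a hpos hQ
          ((NegSup.equiv (levWeight (F.L : ℝ) ((F.P K).eta k) levB 0) (Matrix (Fin N) (Fin N) ℂ)).symm (Pi.single y Z)))) b'‖ ≤ hk' b' y * ‖Z‖)
    {Θ' : ℝ} (hΘ'0 : 0 ≤ Θ')
    (hΘ' : ∀ (bb : Bond (F.P K).d (fun _ => (F.P K).sitesPerDir 0)) (y : PBond (F.P K) k),
      ∑ b', levWeight (F.L : ℝ) ((F.P K).eta k) (bondLevLit F Ω k) 3 bb / levWeight (F.L : ℝ) ((F.P K).eta k) (bondLevLit F Ω k) 1 b' * hk' b' y ≤ Θ')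
    {N₁ : ℝ} (hN₁0 : 0 ≤ N₁)
    (hN₁ : ∀ b', ∑ y, levWeight (F.L : ℝ) ((F.P K).eta k) (bondLevLit F Ω k) 3 b' / levWeight (F.L : ℝ) ((F.P K).eta k) levB 0 y * hk' b' y ≤ N₁)
    (hJ : ‖JOfRecordAtBg F N K k Ω U₀‖ ≤ nJ) :
    letI C₂ : ℝ := (6400000000000 * c𝔥 + 25600000000000000) * (F.L : ℝ) * N
    letI c₄ : ℝ := 1 / (200000000000 * (F.L : ℝ) * N)
    letI r : ℝ := min (c₄ / 4) (min (1 / 2) (1 / (16 * (b * C₂ + 1))))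
    letI R' : ℝ := min r ((1 - 4 * b * C₂ * (r + r)) * (1 / 16))
    letI CV : ℝ := 1024 * (((F.P K).d - 1 : ℕ) : ℝ) * ((1 : ℝ) * 1) ^ 3 * N * (α * (1 : ℝ) ^ 2 + 1 / 16)
        + (((F.P K).d - 1 : ℕ) : ℝ) * ((1 : ℝ) * 1) ^ 3 * (136 + 2 * ((1 : ℝ) * 1)) * N
    letI θ₃ : ℝ := (2 * (1 / (1 - 4 * b * C₂ * (r + r))) + 1) * ΘHw * G / r
    letI θE : ℝ := 2 * ΘHw * G * (1 / (1 - 4 * b * C₂ * (r + r)))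
    letI θE' : ℝ := 2 * Θ' * G * (1 / (1 - 4 * b * C₂ * (r + r)))
    Prop4UniformPrAtRecord F N K k Ω U₀ 𝔥 levB a hpos hQ r Gp
      ((N * θ₃ * nJ + (N₁ * C₂ * (1 / (1 - 4 * b * C₂ * (r + r))) ^ 2 + N * θE')
        + N * θE * (N₁ * C₂ * (1 / (1 - 4 * b * C₂ * (r + r))) ^ 2) * R'
        + N * (1 + θE * R') * CV * (1 / (1 - 4 * b * C₂ * (r + r))) ^ 2)) R' := by
  have hLN : (0 : ℝ) < (F.L : ℝ) * N := mul_pos Fact.out (by exact_mod_cast Nat.pos_of_ne_zero (NeZero.ne N))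
  have hC₂ : (0 : ℝ) ≤ (6400000000000 * c𝔥 + 25600000000000000) * (F.L : ℝ) * N := by rw [mul_assoc]; positivity
  have hc₄ : (0 : ℝ) < 1 / (200000000000 * (F.L : ℝ) * N) := by rw [mul_assoc]; positivity
  have hr0 := radius_pos hb hC₂ hc₄ one_pos
  exact prop4UniformPrAtRecord_node00_of_HCol_pos_param F N K k Ω U₀ 𝔥 levB a hpos hQ Gp hkpos hb hΩ hα0 hα hreg hc0 hc hdom hnear hH
    (prop4LetterColumnsPrAtRecord_of_kernelLetters F N K k Ω U₀ 𝔥 levB a hpos hQ Gp hH (prop4LetterCPrAtRecord_of_regular_param F N k Ω U₀ 𝔥 levB hΩ hα0 hα hreg hc0 hc hdom hnear)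
      (prop4LetterNum_explicit (RV := 1 / 16) hb hC₂ hc₄ (by norm_num)) hr0 hk0 hHk hΘH hH1 hΘHw hHw hgC0 hCg hG0 hG hq hk'0 hNk hΘ'0 hΘ' hN₁0 hN₁) hJ

end ColumnsDoor

end Summit.QuantumFields.YangMills.Theorems.Prop4UniformAtRecord

namespace Summit.QuantumFields.YangMills.Theorems.C44IterMh

section ConeDoor

open Classical

open Literature.MathematicalPhysics.QuantumFieldTheory.Balaban1983to89
open Literature.MathematicalPhysics.QuantumFieldTheory.Balaban1983to89.Node00
open T4Continuum BlockAveraging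
open B10Eq42TorusConstraint (bondsIn mem_bondsIn_iff)
open B10Eq38TorusDomains (toFine toFine_zero)
open B9SectCLatticeCarrier (Bond)
open B11Eq103H1Complex (SiteL2K)
open B11Eq115Space (NegSup NegSize levWeight)
open B11Eq90Transpose (single115)
open B11Eq90V0primeCurrent (flat115)
open B11Eq111FrakG (nabla115)
open Summit.QuantumFields.YangMills.Theorems.Prop4UniformAtRecord (prop4UniformPrAtRecord_node00_of_kernelLetters_param)

variable (F : T4Family) (N : ℕ) [NeZero N] (K k : ℕ) (Ω : ℕ → Set (Site (F.P K) 0)) (U₀ : GaugeField (F.P K) 0 (SU N))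
variable [Fact (0 < (F.L : ℝ))] [Fact (0 < (F.P K).eta k)]

/-- ★★ **THE CONE DOOR, PARAMETRIC IN `c𝔥`** — ✓`prop4UniformPrAtRecord_node00_of_coneLetterPr` with `{c𝔥} (hc0 : 0 ≤ c𝔥) (hc : c𝔥 ≤ 10¹⁰)` and `C₂ := (6.4·10¹²·c𝔥 + 2.56·10¹⁶)·L·N`; glue over ✓`kernelLetterC_of_conePr` ∘ ✓`prop4UniformPrAtRecord_node00_of_kernelLetters_param`.
[cite: Balaban1985Variational, Prop. 4 (97)–(98) pp.292–293, (14) p.280, (46) p.285, (86)–(89) p.291; Balaban1985Averaging, Proposition 5 (157) p.42, (92) p.31; Balaban1985BackgroundPropagators, (3.132) p.422] -/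
theorem prop4UniformPrAtRecord_node00_of_coneLetterPr_param [Fact (0 < c0Rec F K k)] [Fact (∀ c, 0 < wBRec F K k c)] [DecidableEq (PBond (F.P K) k)]
    (𝔥 : FrameDatum (F.P K) N k U₀) (levB : PBond (F.P K) k → ℕ) (a : ℝ)
    (hpos : ∀ x, x ≠ 0 → 0 < RCLike.re ⟪x, laplaceAOfRecord F N k U₀ (QprOfRecord F N k U₀ 𝔥) (QprimeOfRecord F N k U₀) a x⟫_ℂ)
    (hQ : Function.Surjective (QprOfRecord F N k U₀ 𝔥))
    (Gp : SiteL2K ℂ (F.P K).d (fun _ => (F.P K).sitesPerDir 0) (c0Rec F K k) (WRec N) →ₗ[ℂ]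
      SiteL2K ℂ (F.P K).d (fun _ => (F.P K).sitesPerDir 0) (c0Rec F K k) (WRec N))
    {b α nJ : ℝ} (hkpos : 0 < k) (hkm : k ≤ (F.P K).m + (F.P K).K) (hb : 0 ≤ b) (hΩ : ∀ x, x ∈ Ω k) (hα0 : 0 ≤ α) (hα : α * (11000000 * N) ≤ 1)
    (hreg : ∀ j, j < k → PlaqSmall (α * ((F.L : ℝ) ^ j * (F.P K).eta k) ^ 2) (Averaging.iter (avOfRecord F N K) j U₀))
    {c𝔥 : ℝ} (hc0 : 0 ≤ c𝔥) (hc : c𝔥 ≤ 10000000000)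
    (hdom : ∀ Y : PBond (F.P K) 0 → Matrix (Fin N) (Fin N) ℂ, (∀ b, (Y b).trace = 0) → (F.L : ℝ) ^ k * ‖Y‖ < 1 / (25000000000 * (F.L : ℝ) * N) →
      expOver U₀ Y ∈ 𝔥.dom)
    (hnear : ∀ Y : PBond (F.P K) 0 → Matrix (Fin N) (Fin N) ℂ, (∀ b, (Y b).trace = 0) → (F.L : ℝ) ^ k * ‖Y‖ < 1 / (25000000000 * (F.L : ℝ) * N) →
      ∀ y : Site (F.P K) k, ‖𝔥.map (expOver U₀ Y) y - 1‖ ≤ c𝔥 * ((F.L : ℝ) ^ k * ‖Y‖) ∧ ‖𝔥.inv (expOver U₀ Y) y - 1‖ ≤ c𝔥 * ((F.L : ℝ) ^ k * ‖Y‖))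
    (hmap : ∀ Y : Set (Site (F.P K) 0), (∀ i, i < k → ∀ s : Site (F.P K) i, toFine i s ∈ Y ↔ toFine (i + 1) (blockOf s) ∈ Y) →
      ∀ V V' : PBond (F.P K) 0 → Matrix (Fin N) (Fin N) ℂ, (∀ b : PBond (F.P K) 0, b ∈ bondsIn 0 Y → V b = V' b) →
      ∀ y : Site (F.P K) k, toFine k y ∈ Y → 𝔥.map V y = 𝔥.map V' y ∧ 𝔥.inv V y = 𝔥.inv V' y)
    (hderiv : ∀ Y : Set (Site (F.P K) 0), (∀ i, i < k → ∀ s : Site (F.P K) i, toFine i s ∈ Y ↔ toFine (i + 1) (blockOf s) ∈ Y) →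
      ∀ Z Z' : PBond (F.P K) 0 → Matrix (Fin N) (Fin N) ℂ, (∀ b : PBond (F.P K) 0, b ∈ bondsIn 0 Y → Z b = Z' b) →
      ∀ y : Site (F.P K) k, toFine k y ∈ Y → 𝔥.deriv Z y = 𝔥.deriv Z' y)
    (hH : Prop4LetterHPrAtRecord F N K k Ω U₀ 𝔥 levB a hpos hQ b)
    -- (KL-H)
    {hk : Bond (F.P K).d (fun _ => (F.P K).sitesPerDir 0) → PBond (F.P K) k → ℝ} (hk0 : ∀ b' y, 0 ≤ hk b' y)
    (hHk : ∀ (y : PBond (F.P K) k) (Z : Matrix (Fin N) (Fin N) ℂ) (b' : Bond (F.P K).d (fun _ => (F.P K).sitesPerDir 0)),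
      ‖flat115 (H1prOfRecordAtBg F N K k Ω U₀ 𝔥 levB a hpos hQ
          ((NegSup.equiv (levWeight (F.L : ℝ) ((F.P K).eta k) levB 0) (Matrix (Fin N) (Fin N) ℂ)).symm (Pi.single y Z))) b'‖ ≤ hk b' y * ‖Z‖)
    {ΘH : ℝ} (hΘH : 0 ≤ ΘH) (hH1 : ∀ y, ∑ b', hk b' y ≤ ΘH) {ΘHw : ℝ} (hΘHw : 0 ≤ ΘHw)
    (hHw : ∀ (bb : Bond (F.P K).d (fun _ => (F.P K).sitesPerDir 0)) (y : PBond (F.P K) k),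
      ∑ b', levWeight (F.L : ℝ) ((F.P K).eta k) (bondLevLit F Ω k) 3 bb / levWeight (F.L : ℝ) ((F.P K).eta k) (bondLevLit F Ω k) 3 b' * hk b' y ≤ ΘHw)
    -- the ON-CONE ENTRY LETTER of `D C^{sl}` ([B7] (157)'s shape) on `‖A‖ < 2r`, and the window
    {g₀ : ℝ} (hg₀ : 0 ≤ g₀)
    (hg : letI C₂ : ℝ := (6400000000000 * c𝔥 + 25600000000000000) * (F.L : ℝ) * N
      letI c₄ : ℝ := 1 / (200000000000 * (F.L : ℝ) * N)
      letI r : ℝ := min (c₄ / 4) (min (1 / 2) (1 / (16 * (b * C₂ + 1))))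
      ∀ A : Space115Lit F N K k Ω U₀, ‖A‖ < r + r → ∀ (bb : Bond (F.P K).d (fun _ => (F.P K).sitesPerDir 0)) (X : Matrix (Fin N) (Fin N) ℂ) (c : PBond (F.P K) k),
      (bondToLit (F.P K) 0).symm bb ∈ bondsIn 0 {x : Site (F.P K) 0 | B14.Eq22Determines.blockIter k x = c.src ∨ B14.Eq22Determines.blockIter k x = c.tgt} →
      ‖NegSup.equiv (levWeight (F.L : ℝ) ((F.P K).eta k) levB 0) (Matrix (Fin N) (Fin N) ℂ)
        (fderiv ℂ (CslprOfRecord F N K k Ω U₀ 𝔥 levB) A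
          (single115 (lev₁ := pairLevLit F Ω k) (Dc := nabla115 ((F.P K).eta k) (unitsOfRecord F N U₀)) bb X)) c‖ ≤ g₀ * ‖A‖ * ‖X‖)
    (hq : letI C₂ : ℝ := (6400000000000 * c𝔥 + 25600000000000000) * (F.L : ℝ) * N
      letI c₄ : ℝ := 1 / (200000000000 * (F.L : ℝ) * N)
      letI r : ℝ := min (c₄ / 4) (min (1 / 2) (1 / (16 * (b * C₂ + 1))))
      (r + r) * ΘH * (2 * ((F.P K).d : ℝ) * g₀) ≤ 1 / 2)
    -- (KL-N)
    {hk' : Bond (F.P K).d (fun _ => (F.P K).sitesPerDir 0) → PBond (F.P K) k → ℝ} (hk'0 : ∀ b' y, 0 ≤ hk' b' y)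
    (hNk : ∀ (y : PBond (F.P K) k) (Z : Matrix (Fin N) (Fin N) ℂ) (b' : Bond (F.P K).d (fun _ => (F.P K).sitesPerDir 0)),
      ‖NegSup.equiv (levWeight (F.L : ℝ) ((F.P K).eta k) (bondLevLit F Ω k) 3) (Matrix (Fin N) (Fin N) ℂ)
        (DeltaPiCurOfRecord F N K k Ω U₀ Gp (QprimeOfRecord F N k U₀) (H1prOfRecordAtBg F N K k Ω U₀ 𝔥 levB a hpos hQ
          ((NegSup.equiv (levWeight (F.L : ℝ) ((F.P K).eta k) levB 0) (Matrix (Fin N) (Fin N) ℂ)).symm (Pi.single y Z)))) b'‖ ≤ hk' b' y * ‖Z‖)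
    {Θ' : ℝ} (hΘ'0 : 0 ≤ Θ')
    (hΘ' : ∀ (bb : Bond (F.P K).d (fun _ => (F.P K).sitesPerDir 0)) (y : PBond (F.P K) k),
      ∑ b', levWeight (F.L : ℝ) ((F.P K).eta k) (bondLevLit F Ω k) 3 bb / levWeight (F.L : ℝ) ((F.P K).eta k) (bondLevLit F Ω k) 1 b' * hk' b' y ≤ Θ')
    {N₁ : ℝ} (hN₁0 : 0 ≤ N₁)
    (hN₁ : ∀ b', ∑ y, levWeight (F.L : ℝ) ((F.P K).eta k) (bondLevLit F Ω k) 3 b' / levWeight (F.L : ℝ) ((F.P K).eta k) levB 0 y * hk' b' y ≤ N₁)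
    (hJ : ‖JOfRecordAtBg F N K k Ω U₀‖ ≤ nJ) :
    letI C₂ : ℝ := (6400000000000 * c𝔥 + 25600000000000000) * (F.L : ℝ) * N
    letI c₄ : ℝ := 1 / (200000000000 * (F.L : ℝ) * N)
    letI r : ℝ := min (c₄ / 4) (min (1 / 2) (1 / (16 * (b * C₂ + 1))))
    letI R' : ℝ := min r ((1 - 4 * b * C₂ * (r + r)) * (1 / 16))
    letI CV : ℝ := 1024 * (((F.P K).d - 1 : ℕ) : ℝ) * ((1 : ℝ) * 1) ^ 3 * N * (α * (1 : ℝ) ^ 2 + 1 / 16)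
        + (((F.P K).d - 1 : ℕ) : ℝ) * ((1 : ℝ) * 1) ^ 3 * (136 + 2 * ((1 : ℝ) * 1)) * N
    letI G : ℝ := 2 * ((F.P K).d : ℝ) * g₀
    letI θ₃ : ℝ := (2 * (1 / (1 - 4 * b * C₂ * (r + r))) + 1) * ΘHw * G / r
    letI θE : ℝ := 2 * ΘHw * G * (1 / (1 - 4 * b * C₂ * (r + r)))
    letI θE' : ℝ := 2 * Θ' * G * (1 / (1 - 4 * b * C₂ * (r + r)))
    Prop4UniformPrAtRecord F N K k Ω U₀ 𝔥 levB a hpos hQ r Gp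
      ((N * θ₃ * nJ + (N₁ * C₂ * (1 / (1 - 4 * b * C₂ * (r + r))) ^ 2 + N * θE')
        + N * θE * (N₁ * C₂ * (1 / (1 - 4 * b * C₂ * (r + r))) ^ 2) * R'
        + N * (1 + θE * R') * CV * (1 / (1 - 4 * b * C₂ * (r + r))) ^ 2)) R' := by
  have hU₀ : SmallBelow (avOfRecord F N K) k U₀ := (loopProfile_of_regular_below F N k U₀ le_rfl hα0 hα hreg).1
  obtain ⟨hgC0, hCg, hG⟩ := kernelLetterC_of_conePr F N K k Ω U₀ hkm 𝔥 levB hU₀ hmap hderiv hg₀ hg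
  have hG0 : 0 ≤ 2 * ((F.P K).d : ℝ) * g₀ := by positivity
  exact prop4UniformPrAtRecord_node00_of_kernelLetters_param F N K k Ω U₀ 𝔥 levB a hpos hQ Gp hkpos hb hΩ hα0 hα hreg hc0 hc hdom hnear hH hk0 hHk hΘH hH1 hΘHw hHw hgC0 hCg hG0 hG hq
    hk'0 hNk hΘ'0 hΘ' hN₁0 hN₁ hJ

end ConeDoor

end Summit.QuantumFields.YangMills.Theorems.C44IterMh

end
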